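import Literature.NumberTheory.LFunctions.SubnormalZetaGapsKappa
import Literature.NumberTheory.LFunctions.ZetaZeros
import Literature.NumberTheory.LFunctions.ZeroCountingDerivZetaProofs
import HarnessLib

/-!
# CI-GAPS with OFF-LINE zeros admitted: close pairs of zeros of `ζ` IN ℂ, the mirror pairs of the
# functional equation, and `H^ℂ(κ, α)` (cell ls-idea card K6-7 «MIRROR PAIRS», door of record CI-GAPS)

Topic `Literature/NumberTheory/LFunctions`. OBJECTS + a parametric PREDICATE + PROVED bookkeeping;
NOTHING about the actual zeros of `ζ` or about `L(1,χ)` is asserted. Conrey–Iwaniec 2002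
[held: paper:arxiv-math_0111012] prove «many close pairs of CRITICAL zeros ⇒ effective lower bound for
`L(1,χ)`» (Thm 1.1/1.2; tree `conreyIwaniec2002_theorem11/12`, `SubnormalGapsHypothesis`,
`SubnormalGapsHypothesisKappa`) and STATE WITHOUT PROOF (p. 3 L40–L47) that «many sections of this paper
are valid for arbitrary points in the strip … if (1.22) were established for pairs of zeros
`ρ = β + iγ, ρ' = β' + iγ'` which may or may not be on the critical line, then (1.23) would hold».
Card K6-7 (seat ls-idea-lens-6 gen 1; critic A PASS as REQUIREMENT-LEDGER, ownership flag: the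
off-line extension is AUTHOR-ASSERTED, hence an OWNED crux and never a cite-tagged fact) observes that
under that extension the functional equation supplies pairs for free: every zero `β + iγ` with
`0 < |β − ½| ≤ (1−α)π/(2 log γ)` forms with its MIRROR `1 − β + iγ` (same ordinate) a pair at distance
`|2β − 1| ≤ (1−α)π/log γ = gapRadius α γ`. This file types the ℂ-pair objects on the tree's
`ConreyIwaniec2002.gapRadius`, the hypothesis `H^ℂ(κ, α)` (the off-line weakening of K6-5's
`H(κ, α)`), and PROVES: critical close pairs are ℂ-close pairs; the ℂ-ordinate set for `ζ` is finite
(zeros in a box, `zetaZeroBox_finite`); `H(κ,α) ⇒ H^ℂ(κ,α)`; the MIRROR-PAIR lemma; and the «free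
dichotomy» inclusion «collar zeros are counted by `H^ℂ`». The implication «`H^ℂ` ⇒ `L(1,χ)` lower
bound» is NOT typed here (unprinted; the card's owned crux, typed as a criterion Prop on the Summits
side). «The programme SEARCHES and TYPES; no claim about Landau–Siegel zeros, Theorems 1–2 of
arXiv:2211.02515 or a repaired Margin232 until a kernel theorem says so.»

## References
* [ConreyIwaniec2002] J. B. Conrey, H. Iwaniec, Acta Arith. 103 (2002) = arXiv:math/0111012: §1 (1.19),
  (1.22), Thm 1.2, p. 3 L40–L47 (off-line extension asserted), (7.20)/(7.26), Cor 7.6.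
  [held: paper:arxiv-math_0111012 p0002–p0003, p0018]
* [Titchmarsh1986] E. C. Titchmarsh, The theory of the Riemann zeta-function, 2nd ed., §2.12
  (functional equation; zeros symmetric about `σ = ½`).
-/

noncomputable section

namespace Literature.NumberTheory.LFunctions

open Complex ConreyIwaniec2002

/-! ### Objects -/

/-- **A close pair of zeros IN ℂ anchored at the ordinate `γ`** (off-line zeros admitted, card K6-7):
some zero `ρ = β + iγ` of `L` with `0 < β < 1` is a multiple zero, or has ANOTHER zero `ρ' ≠ ρ` of `L`
(any real part, any ordinate) with `|ρ − ρ'| ≤ r`. The critical-line version is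
`ConreyIwaniec2002.HasCloseZero` (`β = β' = ½`). [cite: ConreyIwaniec2002, §1 p. 3 L40–L47 (pairs «which may or may not be on the critical line»)] -/
def HasCloseZeroC (L : ℂ → ℂ) (r γ : ℝ) : Prop :=
  ∃ β : ℝ, 0 < β ∧ β < 1 ∧ L (β + γ * I) = 0 ∧
    (deriv L (β + γ * I) = 0 ∨ ∃ ρ' : ℂ, ρ' ≠ β + γ * I ∧ L ρ' = 0 ∧ ‖(β + γ * I : ℂ) - ρ'‖ ≤ r)

/-- The ℂ-version of the set counted by `D(α,T)`: ordinates `2 ≤ γ ≤ T` anchoring a close pair in ℂ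
at the radius `π(1−α)/log γ` of (1.19). [cite: ConreyIwaniec2002, §1 (1.19) and p. 3 L40–L47] -/
def closeZeroOrdinatesC (L : ℂ → ℂ) (α T : ℝ) : Set ℝ :=
  {γ : ℝ | 2 ≤ γ ∧ γ ≤ T ∧ HasCloseZeroC L (gapRadius α γ) γ}

/-- **`H^ℂ(κ, α)` — the CI-GAPS requirement ledger with OFF-LINE zeros admitted** (card K6-7 (1)):
for all large `T`, at least `T·(log T)^{1−κ}` ordinates `2 ≤ γ ≤ T` anchor a close pair of zeros of
`ζ` IN ℂ at gap fraction `1 − α`. The weakening of K6-5's `SubnormalGapsHypothesisKappa κ α`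
(critical pairs only; `SubnormalGapsHypothesisKappa.toOffLine`). A PREDICATE in `(κ, α)`; never
asserted; whether it implies an effective lower bound for `L(1,χ)` is Conrey–Iwaniec's UNPROVED
assertion (p. 3 L40–L47), not a fact of the tree. [cite: ConreyIwaniec2002, §1 (1.22) and p. 3 L40–L47] -/
def SubnormalGapsHypothesisC (κ α : ℝ) : Prop :=
  ∃ T₀ : ℝ, ∀ T : ℝ, T₀ ≤ T →
    T * Real.log T ^ (1 - κ) ≤ ((closeZeroOrdinatesC riemannZeta α T).ncard : ℝ)

/-- The COLLAR zeros of card K6-7 (2): ordinates `2 ≤ γ ≤ T` carrying an OFF-LINE zero `β + iγ` of `ζ`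
within `(1−α)π/(2 log γ)` of the critical line, i.e. `0 < β < 1`, `β ≠ ½`, `|2β − 1| ≤ gapRadius α γ`.
[cite: ConreyIwaniec2002, §1 (1.19) and p. 3 L40–L47] -/
def collarZeroOrdinates (α T : ℝ) : Set ℝ :=
  {γ : ℝ | 2 ≤ γ ∧ γ ≤ T ∧ ∃ β : ℝ, 0 < β ∧ β < 1 ∧ β ≠ 1 / 2 ∧
    riemannZeta (β + γ * I) = 0 ∧ |2 * β - 1| ≤ gapRadius α γ}

/-! ### Bookkeeping (proved) -/

/-- A critical close pair is a ℂ-close pair (`β = ½`, the neighbour `½ + iγ'` at distance `|γ − γ'|`).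
[cite: ConreyIwaniec2002, §1 (1.19)] -/
theorem hasCloseZeroC_of_hasCloseZero {L : ℂ → ℂ} {r γ : ℝ} (h : HasCloseZero L r γ) :
    HasCloseZeroC L r γ := by
  obtain ⟨hz, hn⟩ := h
  have e : ((1 / 2 : ℝ) : ℂ) + γ * I = 1 / 2 + γ * I := by push_cast; ring
  refine ⟨1 / 2, by norm_num, by norm_num, by rw [e]; exact hz, ?_⟩
  rw [e]
  rcases hn with hd | ⟨γ', hne, hz', hdist⟩
  · exact Or.inl hd
  · refine Or.inr ⟨1 / 2 + γ' * I, fun heq ↦ hne ?_, hz', ?_⟩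
    · have := congrArg Complex.im heq
      simpa using this
    · have hsub : (1 / 2 + γ * I : ℂ) - (1 / 2 + γ' * I) = ((γ - γ' : ℝ) : ℂ) * I := by
        push_cast; ring
      rw [hsub, norm_mul, Complex.norm_I, mul_one, Complex.norm_real, Real.norm_eq_abs]
      exact hdist

/-- The critical close-pair ordinates are among the ℂ-close-pair ordinates.
[cite: ConreyIwaniec2002, §1 (1.19)] -/
theorem closeZeroOrdinates_subset_closeZeroOrdinatesC (L : ℂ → ℂ) (α T : ℝ) :
    closeZeroOrdinates L α T ⊆ closeZeroOrdinatesC L α T :=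
  fun _ ⟨h2, hT, h⟩ ↦ ⟨h2, hT, hasCloseZeroC_of_hasCloseZero h⟩

/-- For `ζ` the ℂ-close-pair ordinates up to `T` form a FINITE set (they are ordinates of zeros in the
box `0 ≤ Re ≤ 1`, `0 < Im ≤ T`, finite by `zetaZeroBox_finite`), so `Set.ncard` counts honestly.
[cite: Titchmarsh1986, §2.12] -/
theorem closeZeroOrdinatesC_riemannZeta_finite (α T : ℝ) :
    (closeZeroOrdinatesC riemannZeta α T).Finite := by
  refine ((zetaZeroBox_finite 0 T).image Complex.im).subset ?_
  rintro γ ⟨h2, hT, β, hβ0, hβ1, hz, -⟩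
  refine ⟨β + γ * I, ⟨hz, ?_, ?_, ?_, ?_⟩, ?_⟩ <;> simp <;> linarith

/-- `H(κ, α) ⇒ H^ℂ(κ, α)`: admitting off-line zeros only WEAKENS the requirement (card K6-7 (1)).
[cite: ConreyIwaniec2002, §1 (1.22) and p. 3 L40–L47] -/
theorem SubnormalGapsHypothesisKappa.toOffLine {κ α : ℝ} (h : SubnormalGapsHypothesisKappa κ α) :
    SubnormalGapsHypothesisC κ α := by
  obtain ⟨T₀, hT⟩ := h
  refine ⟨T₀, fun T hTT ↦ le_trans (hT T hTT) ?_⟩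
  exact_mod_cast Set.ncard_le_ncard (closeZeroOrdinates_subset_closeZeroOrdinatesC riemannZeta α T)
    (closeZeroOrdinatesC_riemannZeta_finite α T)

/-- **MIRROR-PAIR LEMMA (card K6-7).** An off-line zero `β + iγ` of `ζ` (`0 < β < 1`, `β ≠ ½`, `γ > 0`)
forms with its reflection `1 − β + iγ` in the critical line — again a zero, by the functional equation
and conjugation symmetry (tree: `riemannZeta_one_sub_conj_eq_zero`) — a close pair IN ℂ at every radius
`r ≥ |2β − 1|`. [cite: Titchmarsh1986, §2.12] -/
theorem hasCloseZeroC_of_offline_zero {β γ r : ℝ} (hγ : 0 < γ) (hβ0 : 0 < β) (hβ1 : β < 1)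
    (hne : β ≠ 1 / 2) (hz : riemannZeta (β + γ * I) = 0) (hr : |2 * β - 1| ≤ r) :
    HasCloseZeroC riemannZeta r γ := by
  refine ⟨β, hβ0, hβ1, hz, Or.inr ⟨((1 - β : ℝ) : ℂ) + γ * I, fun heq ↦ hne ?_, ?_, ?_⟩⟩
  · have := congrArg Complex.re heq
    simp at this
    linarith
  · have him : 0 < ((β : ℂ) + γ * I).im := by simpa using hγ
    have hmir := riemannZeta_one_sub_conj_eq_zero hz him
    have e : 1 - (starRingEnd ℂ) ((β : ℂ) + γ * I) = ((1 - β : ℝ) : ℂ) + γ * I := by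
      apply Complex.ext <;> simp
    rwa [e] at hmir
  · have hsub : ((β : ℂ) + γ * I) - (((1 - β : ℝ) : ℂ) + γ * I) = ((2 * β - 1 : ℝ) : ℂ) := by
      push_cast; ring
    rw [hsub, Complex.norm_real, Real.norm_eq_abs]
    exact hr

/-- **The «free dichotomy» of card K6-7 (2), as an inclusion: every COLLAR zero ordinate is counted by
`H^ℂ`.** Hence for every `T` either `H^ℂ`'s count at `T` is large, or all but that many zeros with
`γ ≤ T` are on the critical line or outside the collar of width `(1−α)π/log γ` around it — an RH-free
engine may assume «critical or far» without loss. [cite: ConreyIwaniec2002, p. 3 L40–L47 and L107–L111] -/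
theorem collarZeroOrdinates_subset_closeZeroOrdinatesC (α T : ℝ) :
    collarZeroOrdinates α T ⊆ closeZeroOrdinatesC riemannZeta α T := by
  rintro γ ⟨h2, hT, β, hβ0, hβ1, hne, hz, hcol⟩
  exact ⟨h2, hT, hasCloseZeroC_of_offline_zero (by linarith) hβ0 hβ1 hne hz hcol⟩

/-- Counting form of the dichotomy (proved): the collar-zero ordinates up to `T` are at most the
`H^ℂ`-count at `T`. [cite: ConreyIwaniec2002, p. 3 L40–L47] -/
theorem ncard_collarZeroOrdinates_le (α T : ℝ) :
    (collarZeroOrdinates α T).ncard ≤ (closeZeroOrdinatesC riemannZeta α T).ncard :=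
  Set.ncard_le_ncard (collarZeroOrdinates_subset_closeZeroOrdinatesC α T)
    (closeZeroOrdinatesC_riemannZeta_finite α T)

/-- `H^ℂ(κ, α)` is monotone in the density exponent, exactly as `H(κ, α)` (`κ ≤ κ'`).
[cite: ConreyIwaniec2002, Theorem 1.1 (1.20)] -/
theorem SubnormalGapsHypothesisC.mono {κ κ' α : ℝ} (hκ : κ ≤ κ') (h : SubnormalGapsHypothesisC κ α) :
    SubnormalGapsHypothesisC κ' α := by
  obtain ⟨T₀, hT⟩ := h
  refine ⟨max T₀ (Real.exp 1), fun T hTge ↦ ?_⟩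
  have hT₀ : T₀ ≤ T := le_trans (le_max_left _ _) hTge
  have hTe : Real.exp 1 ≤ T := le_trans (le_max_right _ _) hTge
  have hTpos : 0 < T := lt_of_lt_of_le (Real.exp_pos 1) hTe
  have hlog : 1 ≤ Real.log T := by
    have := Real.log_le_log (Real.exp_pos 1) hTe
    rwa [Real.log_exp] at this
  have hpow : Real.log T ^ (1 - κ') ≤ Real.log T ^ (1 - κ) :=
    Real.rpow_le_rpow_of_exponent_le hlog (by linarith)
  exact le_trans (mul_le_mul_of_nonneg_left hpow hTpos.le) (hT T hT₀)

end Literature.NumberTheory.LFunctions
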